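import Mathlib
import Literature.NumberTheory.Sieve.LiouvillePolynomialValuesMaxExpSum
import Literature.NumberTheory.Sieve.LiouvillePolynomialValuesMinorArcEndgame
import Literature.NumberTheory.Sieve.LiouvillePolynomialValuesEquidistribution
import Literature.NumberTheory.Sieve.LiouvillePolynomialValuesWeylAllCoeffs
import HarnessLib

/-!
# Teräväinen 2024, Proposition 5.4, Case 2 (minor arcs) for `±1`-valued sequences

Support file (everything PROVED; no definitions, no named facts) towards the named fact
`Literature.NumberTheory.Sieve.teravainen2024_cor_2_1` (J. Teräväinen, *On the Liouville function
at polynomial arguments*, Amer. J. Math. 146 (2024) = arXiv:2010.07924, Corollary 2.1 ⊂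
Theorem 2.6 for `g_j = λ`, proved in §5). This file assembles **Case 2 of the proof of
Proposition 5.4** (§5.4, pp. 14–15) for a `±1`-valued sequence `g` (the case `q = 2` relevant to
`λ`): if the Weyl sums `∑_{t≤N} e(jP(t))`, `1 ≤ j ≤ M`, of the phase are small (minor arcs), then
by Lemma 5.6 (equidistribution, file IX) every arc `[j/J, (j+1)/J)` receives a fraction
`≤ (1+ε')/J` of the points `P(t) mod 1` ((5.23)), so by Lemma 5.7 (file VI, the explicit endgame)
and Jensen's inequality (file IV) the correlation obeys
`|∑_{t≤N} g(t) e(P(t))| ≤ (2/π + 8ε' + 23/J) N` with `ε' = J (12/(M+1) + 4(M+1)ε_w/π)`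
— strictly less than `N` once `J` is large and `ε_w` small, which is the contradiction closing
Case 2 ("Since `η > 0` is arbitrarily small, this is a contradiction to (5.22)").

* `Teravainen2024.arc_iff_floor_eq` / `sum_card_arcs_eq` — the arcs `[j/J,(j+1)/J)` partition
  `ℝ/ℤ`;
* `Teravainen2024.norm_sum_e_le_of_arcDensity` — for `S ⊆ (0, N]`, if every arc holds
  `≤ (1+ε')N/J` of the points `P(t)`, `t ≤ N`, then
  `‖∑_{t∈S} e(P(t))‖ ≤ N (sin(π #S/N)/π + 4ε' + 8/J) + 2π #S/J` (file VI + discretisation);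
* `Teravainen2024.card_arc_le_of_weylSums` — (5.23) from file IX;
* `Teravainen2024.minorArc_correlation_le` — **the result** above.

## References
* J. Teräväinen, Amer. J. Math. 146 (2024), §5.4, proof of Proposition 5.4, Case 2
  ((5.22)–(5.23) and the end of the proof), arXiv:2010.07924 pp. 14–15. [Teravainen2024]
-/

noncomputable section

open Finset Complex

namespace Literature.NumberTheory.Sieve

namespace Teravainen2024

open Literature.NumberTheory.LFunctions

/-! ### Arcs -/

/-- `x` lies on the arc `[j/J, (j+1)/J)` of `ℝ/ℤ` (`j < J`) iff `⌊J {x}⌋ = j`. [folklore] -/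
theorem arc_iff_floor_eq (x : ℝ) {J j : ℕ} (hJ : 1 ≤ J) (hj : j < J) :
    (∃ k : ℤ, (j : ℝ) / J ≤ x + k ∧ x + k < ((j : ℝ) + 1) / J) ↔ ⌊(J : ℝ) * Int.fract x⌋₊ = j := by
  have hJR : (0 : ℝ) < J := by exact_mod_cast hJ
  have hj1 : ((j : ℝ) + 1) / J ≤ 1 := by
    rw [div_le_one hJR]; exact_mod_cast hj
  constructor
  · rintro ⟨k, hk1, hk2⟩
    have h0 : 0 ≤ x + k := le_trans (by positivity) hk1
    have h1 : x + k < 1 := lt_of_lt_of_le hk2 hj1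
    have hfr : Int.fract x = x + k := by
      rw [Int.fract_eq_iff]
      exact ⟨h0, h1, ⟨-k, by push_cast; ring⟩⟩
    rw [hfr, Nat.floor_eq_iff (mul_nonneg hJR.le h0)]
    rw [div_le_iff₀ hJR] at hk1
    rw [lt_div_iff₀ hJR] at hk2
    constructor <;> linarith
  · intro h
    rw [Nat.floor_eq_iff (mul_nonneg hJR.le (Int.fract_nonneg x))] at h
    have hfr : x + ((-⌊x⌋ : ℤ) : ℝ) = Int.fract x := by rw [Int.fract]; push_cast; ring
    refine ⟨-⌊x⌋, ?_, ?_⟩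
    · rw [hfr, div_le_iff₀ hJR]; linarith [h.1]
    · rw [hfr, lt_div_iff₀ hJR]; linarith [h.2]

open scoped Classical in
/-- The arcs partition: `∑_{j<J} #{t ∈ S : P(t) ∈ [j/J,(j+1)/J) mod 1} = #S`. [folklore] -/
theorem sum_card_arcs_eq (S : Finset ℕ) (P : ℕ → ℝ) {J : ℕ} (hJ : 1 ≤ J) :
    ∑ j ∈ Finset.range J, #(S.filter fun t => ∃ k : ℤ, (j : ℝ) / J ≤ P t + k ∧ P t + k < ((j : ℝ) + 1) / J)
      = #S := by
  classical
  have hJR : (0 : ℝ) < J := by exact_mod_cast hJ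
  rw [Finset.card_eq_sum_card_fiberwise (f := fun t => ⌊(J : ℝ) * Int.fract (P t)⌋₊) (s := S)
    (t := Finset.range J) (fun t _ => by
      rw [Finset.mem_coe, Finset.mem_range]
      rw [Nat.floor_lt (mul_nonneg hJR.le (Int.fract_nonneg _))]
      calc (J : ℝ) * Int.fract (P t) < J * 1 := by
            exact mul_lt_mul_of_pos_left (Int.fract_lt_one _) hJR
        _ = J := mul_one _)]
  refine Finset.sum_congr rfl fun j hj => ?_
  rw [Finset.mem_range] at hj
  congr 1
  ext t
  simp only [Finset.mem_filter]
  rw [arc_iff_floor_eq (P t) hJ hj]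

/-- Points on one arc have nearly equal phases: if `P(t) ∈ [j/J,(j+1)/J) mod 1` then
`‖e(P(t)) - e(j/J)‖ ≤ 2π/J`. [folklore] -/
theorem norm_e_sub_e_arc_le {x : ℝ} {J j : ℕ} (hJ : 1 ≤ J)
    (h : ∃ k : ℤ, (j : ℝ) / J ≤ x + k ∧ x + k < ((j : ℝ) + 1) / J) :
    ‖VdC.e x - VdC.e ((j : ℝ) / J)‖ ≤ 2 * Real.pi / J := by
  obtain ⟨k, hk1, hk2⟩ := h
  have hJR : (0 : ℝ) < J := by exact_mod_cast hJ
  have he : VdC.e x = VdC.e ((j : ℝ) / J + (x + k - (j : ℝ) / J)) := by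
    rw [show (j : ℝ) / J + (x + k - (j : ℝ) / J) = x + k by ring, VdC.e_add_int]
  rw [he]
  refine (norm_e_add_sub_e_le _ _).trans ?_
  have hE : |x + k - (j : ℝ) / J| ≤ 1 / J := by
    rw [abs_le]
    constructor
    · have : (0 : ℝ) ≤ 1 / J := by positivity
      linarith
    · have : ((j : ℝ) + 1) / J = (j : ℝ) / J + 1 / J := by ring
      linarith
  calc 2 * Real.pi * |x + k - (j : ℝ) / J| ≤ 2 * Real.pi * (1 / J) :=
        mul_le_mul_of_nonneg_left hE (by positivity)
    _ = 2 * Real.pi / J := by ring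

/-! ### The endgame for one value class -/

open scoped Classical in
/-- **Lemma 5.7 + discretisation for one value class.** Let `S ⊆ (0, N]`, `J ≥ 4`, `0 ≤ ε' ≤ 1`,
and suppose every arc `[j/J,(j+1)/J)` contains `≤ (1+ε')N/J` of the points `P(t)`, `0 < t ≤ N`.
Then `‖∑_{t∈S} e(P(t))‖ ≤ N (sin(π #S/N)/π + 4ε' + 8/J) + 2π #S/J`.
[cite: Teravainen2024, §5.4, Case 2 ((5.23) ⇒ hypothesis of Lemma 5.7)] -/
theorem norm_sum_e_le_of_arcDensity {N J : ℕ} (hN : 1 ≤ N) (hJ : 4 ≤ J) {ε' : ℝ} (hε0 : 0 ≤ ε')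
    (hε1 : ε' ≤ 1) (P : ℕ → ℝ) {S : Finset ℕ} (hS : S ⊆ Finset.Ioc 0 N)
    (harc : ∀ j < J, (#((Finset.Ioc 0 N).filter fun t =>
        ∃ k : ℤ, (j : ℝ) / J ≤ P t + k ∧ P t + k < ((j : ℝ) + 1) / J) : ℝ) ≤ (1 + ε') * N / J) :
    ‖∑ t ∈ S, VdC.e (P t)‖ ≤
      N * (Real.sin (Real.pi * (#S / N : ℝ)) / Real.pi + 4 * ε' + 8 / J) + 2 * Real.pi * #S / J := by
  classical
  have hJ1 : 1 ≤ J := by omega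
  have hNR : (0 : ℝ) < N := by exact_mod_cast hN
  have hJR : (0 : ℝ) < J := by exact_mod_cast hJ1
  -- arc pieces of `S`
  set A : ℕ → Finset ℕ := fun j => S.filter fun t =>
    ∃ k : ℤ, (j : ℝ) / J ≤ P t + k ∧ P t + k < ((j : ℝ) + 1) / J with hA
  have hsplit : ∑ t ∈ S, VdC.e (P t) = ∑ j ∈ Finset.range J, ∑ t ∈ A j, VdC.e (P t) := by
    rw [hA]
    symm
    have := Finset.sum_fiberwise_of_maps_to (s := S) (t := Finset.range J)
      (g := fun t => ⌊(J : ℝ) * Int.fract (P t)⌋₊) (fun t _ => by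
        rw [Finset.mem_range, Nat.floor_lt (mul_nonneg hJR.le (Int.fract_nonneg _))]
        calc (J : ℝ) * Int.fract (P t) < J * 1 :=
              mul_lt_mul_of_pos_left (Int.fract_lt_one _) hJR
          _ = J := mul_one _) (fun t => VdC.e (P t))
    rw [← this]
    refine Finset.sum_congr rfl fun j hj => ?_
    rw [Finset.mem_range] at hj
    congr 1
    ext t
    simp only [Finset.mem_filter]
    rw [arc_iff_floor_eq (P t) hJ1 hj]
  -- on each arc, replace `e(P t)` by `e(j/J)`
  have happrox : ∀ j < J, ‖∑ t ∈ A j, VdC.e (P t) - (#(A j) : ℂ) * VdC.e ((j : ℝ) / J)‖ ≤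
      #(A j) * (2 * Real.pi / J) := by
    intro j hj
    have e1 : (#(A j) : ℂ) * VdC.e ((j : ℝ) / J) = ∑ t ∈ A j, VdC.e ((j : ℝ) / J) := by
      rw [Finset.sum_const, nsmul_eq_mul]
    rw [e1, ← Finset.sum_sub_distrib]
    refine (norm_sum_le _ _).trans ?_
    calc ∑ t ∈ A j, ‖VdC.e (P t) - VdC.e ((j : ℝ) / J)‖ ≤ ∑ t ∈ A j, 2 * Real.pi / J := by
          refine Finset.sum_le_sum fun t ht => ?_
          rw [hA, Finset.mem_filter] at ht
          exact norm_e_sub_e_arc_le hJ1 ht.2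
      _ = #(A j) * (2 * Real.pi / J) := by rw [Finset.sum_const, nsmul_eq_mul]
  have hsumA : ∑ j ∈ Finset.range J, (#(A j) : ℝ) = #S := by
    have := sum_card_arcs_eq S P hJ1
    rw [hA]
    exact_mod_cast this
  -- the main term via Lemma 5.7 (file VI)
  set α : ℕ → ℝ := fun j => (#(A j) : ℝ) / N with hα
  have hα0 : ∀ j < J, 0 ≤ α j := fun j _ => by rw [hα]; positivity
  have hα1 : ∀ j < J, α j ≤ (1 + ε') / J := by
    intro j hj
    rw [hα]
    simp only
    rw [div_le_iff₀ hNR]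
    have h1 : (#(A j) : ℝ) ≤ #((Finset.Ioc 0 N).filter fun t =>
        ∃ k : ℤ, (j : ℝ) / J ≤ P t + k ∧ P t + k < ((j : ℝ) + 1) / J) := by
      rw [hA]
      exact_mod_cast Finset.card_le_card (Finset.filter_subset_filter _ hS)
    calc (#(A j) : ℝ) ≤ _ := h1
      _ ≤ (1 + ε') * N / J := harc j hj
      _ = (1 + ε') / J * N := by ring
  have hαsum : ∑ j ∈ Finset.range J, α j = #S / N := by
    rw [hα]
    simp only
    rw [← Finset.sum_div, hsumA]
  have hSN : (#S : ℝ) / N ≤ 1 := by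
    rw [div_le_one hNR]
    calc (#S : ℝ) ≤ #(Finset.Ioc 0 N) := by exact_mod_cast Finset.card_le_card hS
      _ = N := by simp
  have hVI := norm_sum_weight_mul_exp_le_sin hJ hε0 hε1 α hα0 hα1 (by rw [hαsum]; exact hSN)
  rw [hαsum] at hVI
  -- `∑_j #(A j) e(j/J) = N ∑_j α_j exp(2πi j/J)`
  have hmain : ∑ j ∈ Finset.range J, (#(A j) : ℂ) * VdC.e ((j : ℝ) / J) =
      (N : ℂ) * ∑ j ∈ Finset.range J, ((α j : ℝ) : ℂ) * Complex.exp (2 * Real.pi * I * (j : ℂ) / J) := by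
    rw [Finset.mul_sum]
    refine Finset.sum_congr rfl fun j _ => ?_
    have hNC : (N : ℂ) ≠ 0 := by exact_mod_cast hNR.ne'
    have he : VdC.e ((j : ℝ) / J) = Complex.exp (2 * Real.pi * I * (j : ℂ) / J) := by
      unfold VdC.e
      congr 1
      push_cast
      ring
    rw [he, hα]
    push_cast
    field_simp
  -- assemble
  have hdiff : ‖∑ t ∈ S, VdC.e (P t) - ∑ j ∈ Finset.range J, (#(A j) : ℂ) * VdC.e ((j : ℝ) / J)‖ ≤
      2 * Real.pi * #S / J := by
    rw [hsplit, ← Finset.sum_sub_distrib]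
    refine (norm_sum_le _ _).trans ?_
    calc ∑ j ∈ Finset.range J, ‖∑ t ∈ A j, VdC.e (P t) - (#(A j) : ℂ) * VdC.e ((j : ℝ) / J)‖
        ≤ ∑ j ∈ Finset.range J, (#(A j) : ℝ) * (2 * Real.pi / J) :=
          Finset.sum_le_sum fun j hj => happrox j (Finset.mem_range.mp hj)
      _ = 2 * Real.pi * #S / J := by rw [← Finset.sum_mul, hsumA]; ring
  have hmainN : ‖∑ j ∈ Finset.range J, (#(A j) : ℂ) * VdC.e ((j : ℝ) / J)‖ ≤
      N * (Real.sin (Real.pi * (#S / N : ℝ)) / Real.pi + 4 * ε' + 8 / J) := by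
    rw [hmain, norm_mul, Complex.norm_natCast]
    exact mul_le_mul_of_nonneg_left hVI hNR.le
  calc ‖∑ t ∈ S, VdC.e (P t)‖
      = ‖(∑ t ∈ S, VdC.e (P t) - ∑ j ∈ Finset.range J, (#(A j) : ℂ) * VdC.e ((j : ℝ) / J)) +
          ∑ j ∈ Finset.range J, (#(A j) : ℂ) * VdC.e ((j : ℝ) / J)‖ := by rw [sub_add_cancel]
    _ ≤ 2 * Real.pi * #S / J + N * (Real.sin (Real.pi * (#S / N : ℝ)) / Real.pi + 4 * ε' + 8 / J) :=
        (norm_add_le _ _).trans (add_le_add hdiff hmainN)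
    _ = _ := by ring

/-! ### (5.23): arcs are not overloaded when the Weyl sums are small -/

open scoped Classical in
/-- **(5.23)** for the points `P(t)`, `0 < t ≤ N`: if `‖∑_{t≤N} e(jP(t))‖ ≤ ε_w N` for
`1 ≤ j ≤ M` then every arc `[j/J,(j+1)/J)` contains at most
`(1/J + 12/(M+1) + 4(M+1)ε_w/π) N` of them (file IX, Erdős–Turán).
[cite: Teravainen2024, §5.4 (5.23)] -/
theorem card_arc_le_of_weylSums {N M J : ℕ} (hN : 1 ≤ N) (hJ : 1 ≤ J) (P : ℕ → ℝ) {εw : ℝ}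
    (hεw : 0 ≤ εw)
    (hW : ∀ j : ℕ, 1 ≤ j → j ≤ M → ‖∑ t ∈ Finset.Ioc 0 N, VdC.e (j * P t)‖ ≤ εw * N)
    (j : ℕ) :
    (#((Finset.Ioc 0 N).filter fun t =>
        ∃ k : ℤ, (j : ℝ) / J ≤ P t + k ∧ P t + k < ((j : ℝ) + 1) / J) : ℝ) ≤
      (1 / J + 12 / (M + 1) + 4 * (M + 1) * εw / Real.pi) * N := by
  classical
  have hNR : (0 : ℝ) < N := by exact_mod_cast hN
  have hJR : (0 : ℝ) < J := by exact_mod_cast hJ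
  haveI : Nonempty ↥(Finset.Ioc 0 N) := ⟨⟨1, Finset.mem_Ioc.mpr ⟨Nat.one_pos, hN⟩⟩⟩
  have hcard : Fintype.card ↥(Finset.Ioc 0 N) = N := by
    rw [Fintype.card_coe]; simp
  set P' : ↥(Finset.Ioc 0 N) → ℝ := fun t => P t.1 with hP'
  have hW' : ∀ i : ℕ, 1 ≤ i → i ≤ M →
      ‖∑ n : ↥(Finset.Ioc 0 N), Complex.exp (2 * Real.pi * I * i * (P' n : ℂ))‖
        ≤ εw * N := by
    intro i hi1 hiM
    have e1 : ∑ n : ↥(Finset.Ioc 0 N), Complex.exp (2 * Real.pi * I * i * (P' n : ℂ)) =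
        ∑ t ∈ Finset.Ioc 0 N, VdC.e (i * P t) := by
      simp only [hP']
      rw [Finset.sum_coe_sort (Finset.Ioc 0 N)
        (fun t => Complex.exp (2 * Real.pi * I * i * (P t : ℂ)))]
      refine Finset.sum_congr rfl fun t _ => ?_
      unfold VdC.e
      congr 1
      push_cast
      ring
    rw [e1]
    exact hW i hi1 hiM
  have hIX := arcDensity_le_of_weylSums P' (M := M) (by positivity : (0 : ℝ) ≤ εw * N) hW'
    (a := (j : ℝ) / J) (b := ((j : ℝ) + 1) / J) (by
      apply div_le_div_of_nonneg_right _ hJR.le; linarith) (by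
      rw [div_le_iff₀ hJR, add_mul, div_mul_cancel₀ _ hJR.ne']
      have : (1 : ℝ) ≤ J := by exact_mod_cast hJ
      linarith)
  rw [hcard] at hIX
  -- the filtered cardinalities agree
  have hfiltN : #(Finset.univ.filter fun n : ↥(Finset.Ioc 0 N) =>
      ∃ k : ℤ, (j : ℝ) / J ≤ P' n + k ∧ P' n + k < ((j : ℝ) + 1) / J) =
      #((Finset.Ioc 0 N).filter fun t =>
        ∃ k : ℤ, (j : ℝ) / J ≤ P t + k ∧ P t + k < ((j : ℝ) + 1) / J) := by
    simp only [hP']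
    rw [Finset.card_filter, Finset.card_filter,
      Finset.sum_coe_sort (Finset.Ioc 0 N) (fun t => if
        (∃ k : ℤ, (j : ℝ) / J ≤ P t + k ∧ P t + k < ((j : ℝ) + 1) / J) then 1 else 0)]
  have hfilt : (#(Finset.univ.filter fun n : ↥(Finset.Ioc 0 N) =>
      ∃ k : ℤ, (j : ℝ) / J ≤ P' n + k ∧ P' n + k < ((j : ℝ) + 1) / J) : ℝ) =
      #((Finset.Ioc 0 N).filter fun t =>
        ∃ k : ℤ, (j : ℝ) / J ≤ P t + k ∧ P t + k < ((j : ℝ) + 1) / J) := by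
    exact_mod_cast hfiltN
  rw [hfilt, div_le_iff₀ hNR] at hIX
  refine hIX.trans (le_of_eq ?_)
  have e2 : ((j : ℝ) + 1) / J - (j : ℝ) / J = 1 / J := by ring
  rw [e2]
  field_simp

/-! ### Case 2 of Proposition 5.4 for `±1`-valued sequences -/

/-- **Teräväinen 2024, Proposition 5.4, Case 2, for `±1`-valued `g`.** Let `N ≥ 1`, `J ≥ 4`,
`g(t) ∈ {1, -1}` for `0 < t ≤ N`, `P : ℕ → ℝ`, and suppose the Weyl sums are small:
`‖∑_{0<t≤N} e(jP(t))‖ ≤ ε_w N` for `1 ≤ j ≤ M`, where `ε' := J(12/(M+1) + 4(M+1)ε_w/π) ≤ 1`. Then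
`‖∑_{0<t≤N} g(t) e(P(t))‖ ≤ (2/π + 8ε' + 23/J) N`.
(For `J` large and `ε'` small the right-hand side is `< (1 - δ)N` for any `δ < 1 - 2/π`: minor-arc
phases cannot correlate with `±1` sequences beyond `2/π`.)
[cite: Teravainen2024, §5.4, proof of Proposition 5.4, Case 2 (pp. 14–15)] -/
theorem minorArc_correlation_le {N J M : ℕ} (hN : 1 ≤ N) (hJ : 4 ≤ J) {εw : ℝ} (hεw : 0 ≤ εw)
    (g : ℕ → ℤ) (hg : ∀ t ∈ Finset.Ioc 0 N, g t = 1 ∨ g t = -1) (P : ℕ → ℝ)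
    (hε' : (J : ℝ) * (12 / (M + 1) + 4 * (M + 1) * εw / Real.pi) ≤ 1)
    (hW : ∀ j : ℕ, 1 ≤ j → j ≤ M → ‖∑ t ∈ Finset.Ioc 0 N, VdC.e (j * P t)‖ ≤ εw * N) :
    ‖∑ t ∈ Finset.Ioc 0 N, (g t : ℂ) * VdC.e (P t)‖ ≤
      (2 / Real.pi + 8 * ((J : ℝ) * (12 / (M + 1) + 4 * (M + 1) * εw / Real.pi)) + 23 / J) * N := by
  classical
  have hJ1 : 1 ≤ J := by omega
  have hNR : (0 : ℝ) < N := by exact_mod_cast hN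
  have hJR : (4 : ℝ) ≤ J := by exact_mod_cast hJ
  have hπ := Real.pi_pos
  set ε' : ℝ := (J : ℝ) * (12 / (M + 1) + 4 * (M + 1) * εw / Real.pi) with hε'def
  have hε'0 : 0 ≤ ε' := by rw [hε'def]; positivity
  -- the two value classes
  set S₁ := (Finset.Ioc 0 N).filter (fun t => g t = 1) with hS₁
  set S₂ := (Finset.Ioc 0 N).filter (fun t => ¬ g t = 1) with hS₂
  have hS₁sub : S₁ ⊆ Finset.Ioc 0 N := Finset.filter_subset _ _
  have hS₂sub : S₂ ⊆ Finset.Ioc 0 N := Finset.filter_subset _ _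
  have hcardsum : (#S₁ : ℝ) + #S₂ = N := by
    have := Finset.card_filter_add_card_filter_not (s := Finset.Ioc 0 N) (fun t => g t = 1)
    rw [Nat.card_Ioc, Nat.sub_zero] at this
    rw [hS₁, hS₂]
    exact_mod_cast this
  have hsplit : ∑ t ∈ Finset.Ioc 0 N, (g t : ℂ) * VdC.e (P t) =
      ∑ t ∈ S₁, VdC.e (P t) - ∑ t ∈ S₂, VdC.e (P t) := by
    rw [← Finset.sum_filter_add_sum_filter_not (Finset.Ioc 0 N) (fun t => g t = 1), sub_eq_add_neg,
      ← Finset.sum_neg_distrib]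
    congr 1
    · refine Finset.sum_congr rfl fun t ht => ?_
      rw [Finset.mem_filter] at ht
      rw [ht.2]; push_cast; ring
    · refine Finset.sum_congr rfl fun t ht => ?_
      rw [Finset.mem_filter] at ht
      rcases hg t ht.1 with h | h
      · exact absurd h ht.2
      · rw [h]; push_cast; ring
  -- arc densities from the Weyl sums
  have harc : ∀ j < J, (#((Finset.Ioc 0 N).filter fun t =>
      ∃ k : ℤ, (j : ℝ) / J ≤ P t + k ∧ P t + k < ((j : ℝ) + 1) / J) : ℝ) ≤ (1 + ε') * N / J := by
    intro j _
    refine (card_arc_le_of_weylSums hN hJ1 P hεw hW j).trans (le_of_eq ?_)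
    rw [hε'def]
    have hJ0 : (J : ℝ) ≠ 0 := by positivity
    field_simp
    ring
  have h1 := norm_sum_e_le_of_arcDensity hN hJ hε'0 hε' P hS₁sub harc
  have h2 := norm_sum_e_le_of_arcDensity hN hJ hε'0 hε' P hS₂sub harc
  -- Jensen for the two densities
  set δf : ℕ → ℝ := fun a => if a = 0 then (#S₁ : ℝ) / N else (#S₂ : ℝ) / N with hδf
  have hδ0 : ∀ a < 2, 0 ≤ δf a := fun a _ => by simp only [hδf]; split_ifs <;> positivity
  have hδ1 : ∀ a < 2, δf a ≤ 1 := by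
    intro a _
    have h1' : (#S₁ : ℝ) / N ≤ 1 := by rw [div_le_one hNR]; linarith [(by positivity : (0:ℝ) ≤ #S₂)]
    have h2' : (#S₂ : ℝ) / N ≤ 1 := by rw [div_le_one hNR]; linarith [(by positivity : (0:ℝ) ≤ #S₁)]
    simp only [hδf]
    split_ifs
    · exact h1'
    · exact h2'
  have hδsum : ∑ a ∈ Finset.range 2, δf a = 1 := by
    simp only [hδf, Finset.sum_range_succ, Finset.sum_range_zero, zero_add, if_true,
      one_ne_zero, if_false]
    rw [← add_div, hcardsum, div_self hNR.ne']
  have hJensen := sum_sin_pi_mul_le (q := 2) (by norm_num) δf hδ0 hδ1 hδsum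
  simp only [hδf, Finset.sum_range_succ, Finset.sum_range_zero, zero_add, if_true,
    one_ne_zero, if_false, Nat.cast_ofNat, Real.sin_pi_div_two, mul_one] at hJensen
  -- assemble
  have hπJ : 2 * Real.pi * (#S₁ : ℝ) / J + 2 * Real.pi * #S₂ / J ≤ 7 / J * N := by
    rw [show 2 * Real.pi * (#S₁ : ℝ) / J + 2 * Real.pi * #S₂ / J = 2 * Real.pi * N / J by
      rw [← hcardsum]; ring]
    rw [div_mul_eq_mul_div, div_le_div_iff_of_pos_right (by linarith)]
    nlinarith [Real.pi_lt_d2, hNR]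
  calc ‖∑ t ∈ Finset.Ioc 0 N, (g t : ℂ) * VdC.e (P t)‖
      = ‖∑ t ∈ S₁, VdC.e (P t) - ∑ t ∈ S₂, VdC.e (P t)‖ := by rw [hsplit]
    _ ≤ ‖∑ t ∈ S₁, VdC.e (P t)‖ + ‖∑ t ∈ S₂, VdC.e (P t)‖ := norm_sub_le _ _
    _ ≤ N * (Real.sin (Real.pi * (#S₁ / N : ℝ)) / Real.pi + 4 * ε' + 8 / J) + 2 * Real.pi * #S₁ / J
        + (N * (Real.sin (Real.pi * (#S₂ / N : ℝ)) / Real.pi + 4 * ε' + 8 / J)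
          + 2 * Real.pi * #S₂ / J) := add_le_add h1 h2
    _ = N * ((Real.sin (Real.pi * (#S₁ / N : ℝ)) + Real.sin (Real.pi * (#S₂ / N : ℝ))) / Real.pi)
        + N * (8 * ε' + 16 / J) + (2 * Real.pi * (#S₁ : ℝ) / J + 2 * Real.pi * #S₂ / J) := by ring
    _ ≤ N * (2 / Real.pi) + N * (8 * ε' + 16 / J) + 7 / J * N := by
        refine add_le_add (add_le_add ?_ le_rfl) hπJ
        apply mul_le_mul_of_nonneg_left _ hNR.le
        exact div_le_div_of_nonneg_right hJensen hπ.le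
    _ = (2 / Real.pi + 8 * ε' + 23 / J) * N := by ring

end Teravainen2024

end Literature.NumberTheory.Sieve
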